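/-
Copyright: statement-level skeleton of a published paper (lit-balaban cell, reader/typer r15). No proof claims beyond
what the kernel checks below.
-/
import Mathlib
import Literature.MathematicalPhysics.QuantumFieldTheory.Balaban1983to89.Setup

/-!
# BIJ85 — T. Bałaban, J. Imbrie, A. Jaffe, *Renormalization of the Higgs model: minimizers, propagators and the
stability of mean field theory*, CMP **97** (1985) 299–329, Sect. 1 (the model (1.1)–(1.2)) and Sect. 2 (2.7), (2.11)–(2.12)

statement-level skeleton of published theorems with citation tags; proofs where landed; nothing here is a claim about
the Yang–Mills mass gap

Source: held text `paper:balaban1985-cmp97-bij-higgs-minimizers` (journal page = PDF page + 298); renders of pp. 300,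
301, 303 read as images (`HOME/lit-balaban-r15/pages/1985-cmp97-bij-higgs-minimizers-p002/p003-x2.png`,
`pub-balaban/t4/b2b-balaban-t4-lit2/renders/bij1985/…-p005-x2.png`).  Rows `C1.Eq1.1`, `C1.Eq1.2`, `C1.Txt@301`,
`C1.Eq2.7`, `C1.Eq2.11-2.12` of `HOME/lit-balaban-r15/ROWS-C1.md`.

CARRIER.  The unit lattice is the torus `T^{(j)}` OF RECORD of the series (`…Balaban1983to89.Site P j`, `PBond P j`,
`Plaq P j` of `Setup`; periodic boundary conditions as in the paper, p. 321 *"Since we study periodic boundary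
conditions"*); the compact abelian gauge field is `u : PBond P j → Circle` (Mathlib's unit circle `U(1) ⊂ ℂ`), the Higgs
field `φ : Site P j → ℂ`.  (The series' `GaugeField P j G` asks for a `[GaugeGroup G]` instance carrying `Re tr`,
`|· − 1|`; for `U(1)` these are `Re z` and `|z − 1|` and the plaquette variable below is `GaugeField.plaqHol` verbatim —
we keep the file instance-free and self-contained.)

## What is typed, and how

* **(1.1)** p. 300 [PDF 2]: *"S(u, φ) = Σ_p e(ε)^{−2}(1 − Re u(p)) + ½Σ_b |(D_uφ)_b|² + Σ_x P(φ_x) + E. (1.1) … The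
  gauge field u : bonds → U(1), and u(p) ≡ Π_{b∈∂p} u_b. Furthermore, we assume b^{−1} = (b₊, b₋) and
  u_b^{−1} = u_{b^{−1}}. The covariant derivative D_uφ is defined by (D_uφ)_b = u_bφ_{b₊} − φ_{b₋}, and the coupling
  constant e(ε) is e(ε) = eε^{(4−d)/2}."* — `plaq`, `covDeriv`, `eEps`, `action` (defs with bodies).
* **(1.2)** p. 300: *"P(ξ) = λ(ε)|ξ|⁴ − ¼(m² + δm²)ε²|ξ|², (1.2) where λ(ε) = λε^{4−d}."* — `selfInt`, `lamEps`.
* **(2.7)** p. 303 [PDF 5]: *"let h denote a map from the unit lattice to U(1). Then h defines the gauge transformation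
  φ_y → h(y)φ_y ≡ φ^h_y, u_b → h(b₋)h(b₊)^{−1}u_b = u^h_b. (2.7)"* — `gaugeHiggs`, `gaugeU`; PROVED: the plaquette
  variable, |D_uφ|, |φ| and hence the action (1.1) are gauge invariant (`plaq_gauge`, `norm_covDeriv_gauge`,
  `action_gauge`) — the invariance used on p. 320 (6.3.2) *"it is clear in the case of the quadratic forms for which
  we write explicit formulas"*.
* **p. 301** [PDF 3]: *"we can define the plaquette field f_p = (ie(ε))^{−1} ln u(p), so for small f_p,
  Σ_p e(ε)^{−2}(1 − Re u(p)) = Σ_p ½f_p² + O(e(ε)²)."* — PROVED per plaquette with an explicit constant: for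
  u(p) = exp(i e f), |e^{−2}(1 − cos(e f)) − ½f²| ≤ (5/96)e²f⁴ whenever |e f| ≤ 1 (`wilson_quadratic_approx`; kernel:
  Mathlib `Real.cos_bound`).
* **(2.11)–(2.12)** p. 303: *"In (2.10) choose the logarithm so that −π ≤ arg ln u < π. (2.11) With this choice, the
  discontinuity of ln u occurs at u = −1 … Suppose that we can define A_b = (ie(ε))^{−1} ln u_b. (2.12)"* — `argB`
  (the printed branch [−π, π); Mathlib's `Complex.arg` takes values in (−π, π], the two differ only AT u = −1),
  `argB_mem_Ico`, `exp_argB` (exp(i·argB u) = u on the circle), `bondPotential` ((2.12)).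
-/

open scoped BigOperators ComplexConjugate Real

namespace Literature.MathematicalPhysics.QuantumFieldTheory.BalabanImbrieJaffe1984to88.BIJ85Sect1Model

noncomputable section

open Literature.MathematicalPhysics.QuantumFieldTheory.Balaban1983to89

variable {P : Params} {j : ℕ}

/-! ### (1.1)–(1.2): the unit-lattice action of the U(1) Higgs model -/

/-- The compact abelian gauge field *"u : bonds → U(1)"* on the positively oriented bonds of `T^{(j)}`
(`u_{b^{−1}} = u_b^{−1}`). [cite: BalabanImbrieJaffe1985, (1.1) p.300] -/
abbrev U1Field (P : Params) (j : ℕ) : Type := PBond P j → Circle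

/-- The complex scalar (Higgs) field on the sites of `T^{(j)}`. [cite: BalabanImbrieJaffe1985, (1.1) p.300] -/
abbrev HiggsField (P : Params) (j : ℕ) : Type := Site P j → ℂ

/-- *"u(p) ≡ Π_{b∈∂p} u_b"* for `p = ⟨x, x+e_μ, x+e_μ+e_ν, x+e_ν⟩`: `u(x,μ) u(x+e_μ,ν) u(x+e_ν,μ)⁻¹ u(x,ν)⁻¹`
(the formula of `GaugeField.plaqHol`). [cite: BalabanImbrieJaffe1985, (1.1) p.300] -/
def plaq (u : U1Field P j) (p : Plaq P j) : Circle :=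
  u ⟨p.src, p.μ⟩ * u ⟨p.src.shift p.μ, p.ν⟩ * (u ⟨p.src.shift p.ν, p.μ⟩)⁻¹ * (u ⟨p.src, p.ν⟩)⁻¹

/-- *"(D_uφ)_b = u_bφ_{b₊} − φ_{b₋}"*. [cite: BalabanImbrieJaffe1985, (1.1) p.300] -/
def covDeriv (u : U1Field P j) (φ : HiggsField P j) (b : PBond P j) : ℂ :=
  (u b : ℂ) * φ b.tgt - φ b.src

/-- *"e(ε) = eε^{(4−d)/2}"*. [cite: BalabanImbrieJaffe1985, (1.1) p.300] -/
def eEps (e ε : ℝ) (d : ℕ) : ℝ := e * ε ^ ((4 - (d : ℝ)) / 2)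

/-- *"λ(ε) = λε^{4−d}"*. [cite: BalabanImbrieJaffe1985, (1.2) p.300] -/
def lamEps (lam ε : ℝ) (d : ℕ) : ℝ := lam * ε ^ (4 - (d : ℝ))

/-- **(1.2)** *"P(ξ) = λ(ε)|ξ|⁴ − ¼(m² + δm²)ε²|ξ|²"*, with the couplings passed as `lamε = λ(ε)` and
`μsq = (m² + δm²)ε²`. [cite: BalabanImbrieJaffe1985, (1.2) p.300] -/
def selfInt (lamε μsq : ℝ) (ξ : ℂ) : ℝ := lamε * ‖ξ‖ ^ 4 - (1 / 4) * μsq * ‖ξ‖ ^ 2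

/-- **(1.1)** *"S(u, φ) = Σ_p e(ε)^{−2}(1 − Re u(p)) + ½Σ_b |(D_uφ)_b|² + Σ_x P(φ_x) + E"* (sums over the plaquettes,
bonds, sites of the periodic unit lattice; `eε = e(ε)`, `E` the constant). [cite: BalabanImbrieJaffe1985, (1.1) p.300] -/
def action (eε lamε μsq E : ℝ) (u : U1Field P j) (φ : HiggsField P j) : ℝ :=
  (∑ p : Plaq P j, eε⁻¹ ^ 2 * (1 - ((plaq u p : Circle) : ℂ).re)) +
    (1 / 2) * (∑ b : PBond P j, ‖covDeriv u φ b‖ ^ 2) + (∑ x : Site P j, selfInt lamε μsq (φ x)) + E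

/-- The Wilson term is nonnegative plaquette by plaquette: `1 − Re u(p) ≥ 0`. [cite: BalabanImbrieJaffe1985, (1.1) p.300] -/
theorem one_sub_re_plaq_nonneg (u : U1Field P j) (p : Plaq P j) : 0 ≤ 1 - ((plaq u p : Circle) : ℂ).re := by
  have h := Complex.re_le_norm ((plaq u p : Circle) : ℂ)
  rw [Circle.norm_coe] at h
  linarith

/-! ### (2.7): gauge transformations and the gauge invariance of (1.1) -/

/-- **(2.7)** *"φ_y → h(y)φ_y ≡ φ^h_y"*. [cite: BalabanImbrieJaffe1985, (2.7) p.303] -/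
def gaugeHiggs (h : Site P j → Circle) (φ : HiggsField P j) : HiggsField P j := fun y => (h y : ℂ) * φ y

/-- **(2.7)** *"u_b → h(b₋)h(b₊)^{−1}u_b = u^h_b"*. [cite: BalabanImbrieJaffe1985, (2.7) p.303] -/
def gaugeU (h : Site P j → Circle) (u : U1Field P j) : U1Field P j := fun b => h b.src * (h b.tgt)⁻¹ * u b

/-- `(x + e_μ)_κ` (lattice API for the plaquette of (1.1)). [cite: BalabanImbrieJaffe1985, (1.1) p.300] -/
private theorem shift_apply (x : Site P j) (μ κ : Fin P.d) :
    x.shift μ κ = if κ = μ then x κ + 1 else x κ := by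
  unfold Site.shift
  by_cases h : κ = μ
  · subst h; simp
  · simp [h]

/-- Lattice shifts in two directions commute (lattice API for the plaquette of (1.1): x + e_μ + e_ν = x + e_ν + e_μ). [cite: BalabanImbrieJaffe1985, (1.1) p.300] -/
private theorem shift_comm (x : Site P j) (μ ν : Fin P.d) : (x.shift μ).shift ν = (x.shift ν).shift μ := by
  funext κ
  simp only [shift_apply]
  split_ifs <;> rfl

/-- `u(p)` is gauge invariant (abelian group: the four factors h cancel around the plaquette).
[cite: BalabanImbrieJaffe1985, (2.7) p.303] -/
theorem plaq_gauge (h : Site P j → Circle) (u : U1Field P j) (p : Plaq P j) :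
    plaq (gaugeU h u) p = plaq u p := by
  have hc : (p.src.shift p.μ).shift p.ν = (p.src.shift p.ν).shift p.μ := shift_comm p.src p.μ p.ν
  simp only [plaq, gaugeU, PBond.tgt, hc]
  -- an identity in the commutative group `Circle`; checked in `ℂ` (all circle elements are nonzero)
  apply Circle.ext
  push_cast
  field_simp

/-- `|(D_{u^h}φ^h)_b| = |(D_uφ)_b|`: `(D_{u^h}φ^h)_b = h(b₋)(D_uφ)_b`. [cite: BalabanImbrieJaffe1985, (2.7) p.303] -/
theorem norm_covDeriv_gauge (h : Site P j → Circle) (u : U1Field P j) (φ : HiggsField P j) (b : PBond P j) :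
    ‖covDeriv (gaugeU h u) (gaugeHiggs h φ) b‖ = ‖covDeriv u φ b‖ := by
  have key : covDeriv (gaugeU h u) (gaugeHiggs h φ) b = (h b.src : ℂ) * covDeriv u φ b := by
    simp only [covDeriv, gaugeU, gaugeHiggs, Circle.coe_mul, Circle.coe_inv]
    have hz : (h b.tgt : ℂ) ≠ 0 := Circle.coe_ne_zero _
    field_simp
  rw [key, norm_mul, Circle.norm_coe, one_mul]

/-- `|φ^h_x| = |φ_x|`. [cite: BalabanImbrieJaffe1985, (2.7) p.303] -/
theorem norm_gaugeHiggs (h : Site P j → Circle) (φ : HiggsField P j) (x : Site P j) :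
    ‖gaugeHiggs h φ x‖ = ‖φ x‖ := by
  simp [gaugeHiggs]

/-- Gauge invariance of the action (1.1): `S(u^h, φ^h) = S(u, φ)` — the invariance (6.3.2) p. 320 *"clear in the case
of the quadratic forms for which we write explicit formulas"*, here for the full action.
[cite: BalabanImbrieJaffe1985, (1.1) p.300] -/
theorem action_gauge (eε lamε μsq E : ℝ) (h : Site P j → Circle) (u : U1Field P j) (φ : HiggsField P j) :
    action eε lamε μsq E (gaugeU h u) (gaugeHiggs h φ) = action eε lamε μsq E u φ := by
  simp only [action, plaq_gauge, norm_covDeriv_gauge, selfInt, norm_gaugeHiggs]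

/-! ### p. 301: the Wilson term is ½f_p² up to O(e(ε)²) -/

/-- p. 301 [PDF 3]: *"we can define the plaquette field f_p = (ie(ε))^{−1} ln u(p), so for small f_p,
Σ_p e(ε)^{−2}(1 − Re u(p)) = Σ_p ½f_p² + O(e(ε)²). The error term vanishes pointwise as ε → 0 for d < 4"* — per
plaquette, with `u(p) = exp(i e f)` (so `Re u(p) = cos(e f)`) and the explicit constant 5/96: for `|e f| ≤ 1`,
`|e^{−2}(1 − cos(e f)) − ½f²| ≤ (5/96)e²f⁴`.  PROVED (Mathlib `Real.cos_bound`). [cite: BalabanImbrieJaffe1985, p.301] -/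
theorem wilson_quadratic_approx (e f : ℝ) (he : e ≠ 0) (hef : |e * f| ≤ 1) :
    |e⁻¹ ^ 2 * (1 - Real.cos (e * f)) - f ^ 2 / 2| ≤ 5 / 96 * e ^ 2 * f ^ 4 := by
  have hb := Real.cos_bound hef
  have he2 : 0 < e ^ 2 := by positivity
  have hrew : e⁻¹ ^ 2 * (1 - Real.cos (e * f)) - f ^ 2 / 2 =
      -(e⁻¹ ^ 2 * (Real.cos (e * f) - (1 - (e * f) ^ 2 / 2))) := by
    field_simp
    ring
  rw [hrew, abs_neg, abs_mul, abs_of_pos (by positivity : (0 : ℝ) < e⁻¹ ^ 2)]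
  calc e⁻¹ ^ 2 * |Real.cos (e * f) - (1 - (e * f) ^ 2 / 2)| ≤ e⁻¹ ^ 2 * (|e * f| ^ 4 * (5 / 96)) :=
        mul_le_mul_of_nonneg_left hb (by positivity)
    _ = 5 / 96 * e ^ 2 * f ^ 4 := by
        rw [show |e * f| ^ 4 = (e * f) ^ 4 by rw [← abs_pow]; exact abs_of_nonneg (by positivity)]
        field_simp

/-! ### (2.11)–(2.12): the branch of the logarithm and the bond potentials -/

/-- **(2.11)** *"choose the logarithm so that −π ≤ arg ln u < π. (2.11) With this choice, the discontinuity of ln u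
occurs at u = −1"* — the printed branch of the argument, valued in `[−π, π)` (Mathlib's `Complex.arg ∈ (−π, π]`; the
two agree except at `u = −1`, where the printed value is `−π`). [cite: BalabanImbrieJaffe1985, (2.11) p.303] -/
def argB (z : ℂ) : ℝ := if Complex.arg z = π then -π else Complex.arg z

/-- `−π ≤ argB z < π`, as printed in (2.11). [cite: BalabanImbrieJaffe1985, (2.11) p.303] -/
theorem argB_mem_Ico (z : ℂ) : argB z ∈ Set.Ico (-π) π := by
  unfold argB
  have h1 := Complex.neg_pi_lt_arg z
  have h2 := Complex.arg_le_pi z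
  split_ifs with h
  · exact ⟨le_rfl, by linarith [Real.pi_pos]⟩
  · exact ⟨h1.le, lt_of_le_of_ne h2 h⟩

/-- `exp(i · argB u) = u` for `u` on the unit circle: `argB` IS a branch of `(1/i) ln u`.
[cite: BalabanImbrieJaffe1985, (2.11) p.303] -/
theorem exp_argB (u : Circle) : Complex.exp (argB (u : ℂ) * Complex.I) = (u : ℂ) := by
  have hmain : Complex.exp (Complex.arg (u : ℂ) * Complex.I) = (u : ℂ) := by
    have h := Complex.norm_mul_exp_arg_mul_I (u : ℂ)
    rwa [Circle.norm_coe, Complex.ofReal_one, one_mul] at h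
  unfold argB
  split_ifs with h
  · -- at u = −1: exp(−iπ) = exp(iπ) = −1
    rw [← hmain, h]
    push_cast
    rw [neg_mul, Complex.exp_neg, Complex.exp_pi_mul_I]
    norm_num
  · exact hmain

/-- **(2.12)** *"A_b = (ie(ε))^{−1} ln u_b"* with the branch (2.11): the real bond potential `argB(u_b)/e(ε)`.
[cite: BalabanImbrieJaffe1985, (2.12) p.303] -/
def bondPotential (eε : ℝ) (u : U1Field P j) (b : PBond P j) : ℝ := argB (u b : ℂ) / eε

/-- `u_b = exp(i e(ε) A_b)` for the bond potential (2.12) (`e(ε) ≠ 0`). [cite: BalabanImbrieJaffe1985, (2.12) p.303] -/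
theorem exp_bondPotential (eε : ℝ) (heε : eε ≠ 0) (u : U1Field P j) (b : PBond P j) :
    Complex.exp ((eε * bondPotential eε u b : ℝ) * Complex.I) = (u b : ℂ) := by
  have : eε * bondPotential eε u b = argB (u b : ℂ) := by
    unfold bondPotential; field_simp
  rw [this, exp_argB]

end

end Literature.MathematicalPhysics.QuantumFieldTheory.BalabanImbrieJaffe1984to88.BIJ85Sect1Model
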